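import Literature.Barriers.CriticalPhenomena.TreesPercolatingAtCriticalityTree
import Literature.Probability.Percolation.SecondMomentMethod
import Literature.Probability.Percolation.BernoulliPercolation
import Literature.Probability.Percolation.SubgraphMonotonicity
import Mathlib.Analysis.SpecificLimits.Normed
import HarnessLib

/-!
# A spherically symmetric tree percolating at criticality: the percolation estimates

Support file for `Literature/Barriers/CriticalPhenomena/TreesPercolatingAtCriticality.lean`
(Lyons–Peres 2016, Exercise 5.12 / Exercise 5.51 (b)). For the tree `CritTree.tree` of
`TreesPercolatingAtCriticalityTree.lean` (level `n` has `2 ^ lvExp n = 2^n · 4^{size n}` vertices)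
and Bernoulli bond percolation `P_p = bondPercolation tree p` of the prelude, rooted at
`CritTree.root`:

* **first moment** (Lyons–Peres 2016, Prop. 5.8 and (5.6): `P[o ↔ ∞] ≤ Σ_{x ∈ T_n} P[o ↔ x] =
  |T_n| pⁿ`): `theta_le_two_pow_lvExp_mul_pow`, `θ_o(p) ≤ 2^{lvExp n} pⁿ = 4^{size n} (2p)ⁿ
  ≤ (2n+1)² (2p)ⁿ`, whence `theta_eq_zero_of_lt_half`: `θ_o(p) = 0` for `p < 1/2`;
* **second moment at `p = 1/2`** (Lyons–Peres 2016, Prop. 5.11 with (5.11) for the uniform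
  measure on the level cutset `T_n`, i.e. Exercise 5.51 (b)): the paths to `x, y ∈ T_n` share at
  most `|x ∧ y|` edges, so `4ⁿ P[o ↔ x, o ↔ y] ≤ 2^{|x ∧ y|}`, and by spherical symmetry
  `Σ_{y ∈ T_n} 2^{|x ∧ y|} ≤ Σ_{k ≤ n} 2^k |T_n|/|T_k|`; with `Σ_{k ≤ n} 2^k/|T_k| =
  Σ_{k ≤ n} 4^{-size k} ≤ Σ_{k ≤ n} (k+1)^{-2} ≤ 2` this gives `E[X_n²] ≤ 2 E[X_n]²` for the number
  `X_n` of level-`n` vertices joined to the root along open tree paths, and the Cauchy–Schwarz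
  bound of `SecondMomentMethod.lean` yields `P_{1/2}[o ↔ T_n] ≥ 1/2` for every `n`
  (`half_le_real_levelOpen`); continuity from above along the decreasing events `[o ↔ T_n]`
  (ibid. (5.9)) gives `θ_o(1/2) ≥ 1/2` (`half_le_theta_half`);
* hence `p_c = 1/2` exactly (`criticalProb_eq_half`, from the definition of `p_c` as an infimum,
  no monotonicity needed) and `θ_o(p_c) > 0` (`theta_criticalProb_pos`);
* transfer along a bijection of vertex types (`theta_comap_equiv`, `criticalProb_comap_equiv`,
  `neighborSet_comap_equiv_finite`), used in `TreesPercolatingAtCriticalityProofs.lean` to move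
  the witness to the vertex type `ℕ`.

## References

* R. Lyons, Y. Peres, *Probability on Trees and Networks*, CUP 2016: §5.2 Prop. 5.8, (5.6);
  §5.3 Prop. 5.11, (5.9), (5.11); Exercise 5.12 (p. 243); Exercise 5.51 (b) (p. 268).
  [LyonsPeres2016]
-/

noncomputable section

namespace Literature.Barriers.CriticalPhenomena

namespace CritTree

open _root_.MeasureTheory _root_.ProbabilityTheory _root_.Filter
open Literature.Probability.Percolation
open scoped Topology

/-! ### The path events under `P_p` -/

/-- `pathOpen v` is a finite intersection of one-edge cylinders. [folklore] -/
theorem pathOpen_eq_biInter (v : Vert) :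
    pathOpen v = ⋂ e ∈ pathEdges v, {ω : BondConfig Vert | e ∈ ω} := by
  ext ω
  simp only [mem_pathOpen, Set.subset_def, Finset.mem_coe, Set.mem_iInter, Set.mem_setOf_eq]

/-- `pathOpen v` is measurable. [folklore] -/
theorem measurableSet_pathOpen (v : Vert) : MeasurableSet (pathOpen v) := by
  rw [pathOpen_eq_biInter]
  exact Finset.measurableSet_biInter _ fun e _ => measurableSet_mem e

/-- `levelOpen n` is measurable. [folklore] -/
theorem measurableSet_levelOpen (n : ℕ) : MeasurableSet (levelOpen n) :=
  Finset.measurableSet_biUnion _ fun _ _ => measurableSet_pathOpen _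

/-- **`P_p[all edges of the path o → v open] = p^{|v|}`** (Lyons–Peres 2016, §5.2:
"`P[o ↔ e] = p^{|e|+1}`" on a tree). [cite: LyonsPeres2016, §5.2 (proof of (5.6))] -/
theorem real_pathOpen (p : unitInterval) (v : Vert) :
    (bondPercolation tree p).real (pathOpen v) = (p : ℝ) ^ v.1.1 := by
  rw [pathOpen, bondPercolation_real_setOf_subset tree p (pathEdges v) (pathEdges_subset_edgeSet v),
    card_pathEdges]

/-- Two path events together ask for the union of the two paths to be open. [folklore] -/
theorem pathOpen_inter (v w : Vert) :
    pathOpen v ∩ pathOpen w = {ω : BondConfig Vert | ↑(pathEdges v ∪ pathEdges w) ⊆ ω} := by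
  ext ω
  simp only [Set.mem_inter_iff, mem_pathOpen, Set.mem_setOf_eq, Finset.coe_union,
    Set.union_subset_iff]

/-- `P_p[o ↔ v, o ↔ w along the tree] = p^{|path(v) ∪ path(w)|}`.
[cite: LyonsPeres2016, §5.3 (5.11)] -/
theorem real_pathOpen_inter (p : unitInterval) (v w : Vert) :
    (bondPercolation tree p).real (pathOpen v ∩ pathOpen w) =
      (p : ℝ) ^ (pathEdges v ∪ pathEdges w).card := by
  rw [pathOpen_inter]
  refine bondPercolation_real_setOf_subset tree p _ ?_
  rw [Finset.coe_union, Set.union_subset_iff]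
  exact ⟨pathEdges_subset_edgeSet v, pathEdges_subset_edgeSet w⟩

/-! ### First moment: `θ_o(p) ≤ |T_n| pⁿ`, so `θ_o(p) = 0` for `p < 1/2` -/

/-- Along an open walk that uses only edges of the tree, "all edges of the tree path from the
root are open" propagates from the start to the end of the walk. [cite: LyonsPeres2016, §5.2 (proof of (5.6))] -/
theorem pathEdges_subset_of_walk {ω : BondConfig Vert} (hω : ω ⊆ tree.edgeSet) {a b : Vert}
    (w : (openGraph ω).Walk a b) (ha : ↑(pathEdges a) ⊆ ω) : ↑(pathEdges b) ⊆ ω := by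
  induction w with
  | nil => exact ha
  | @cons x y z hadj _ ih =>
    apply ih
    rw [openGraph_adj] at hadj
    have hT : tree.Adj x y := hω hadj.1
    rcases tree_adj.1 hT with ⟨hp, hy⟩ | ⟨hp, -⟩
    · obtain ⟨n, hn⟩ : ∃ n, y.1.1 = n + 1 :=
        ⟨y.1.1 - 1, (Nat.succ_pred_eq_of_pos (level_pos_of_ne_root hy)).symm⟩
      rw [pathEdges_eq_insert hn, hp, Finset.coe_insert]
      exact Set.insert_subset hadj.1 ha
    · rw [← hp]
      exact Set.Subset.trans (Finset.coe_subset.2 (pathEdges_parent_subset x)) ha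

/-- If only edges of the tree are open, every vertex of the open cluster of the root has all
edges of its tree path open. [cite: LyonsPeres2016, §5.2 (proof of (5.6))] -/
theorem pathEdges_subset_of_mem_openCluster {ω : BondConfig Vert} (hω : ω ⊆ tree.edgeSet)
    {u : Vert} (hu : u ∈ openCluster ω root) : ↑(pathEdges u) ⊆ ω := by
  obtain ⟨w⟩ := (hu : (openGraph ω).Reachable root u)
  exact pathEdges_subset_of_walk hω w (by simp)

/-- **The level-`n` cutset** (Lyons–Peres 2016, Prop. 5.8): if the cluster of the root is
infinite (and only tree edges are open) then some level-`n` vertex is joined to the root along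
its tree path. [cite: LyonsPeres2016, §5.2 Prop. 5.8] -/
theorem percolatesAt_inter_subset_levelOpen (n : ℕ) :
    percolatesAt root ∩ {ω : BondConfig Vert | ω ⊆ tree.edgeSet} ⊆ levelOpen n := by
  rintro ω ⟨hperc, hω⟩
  have hinf : (openCluster ω root).Infinite := hperc
  obtain ⟨u, huC, hun⟩ : ∃ u ∈ openCluster ω root, n ≤ u.1.1 := by
    by_contra h
    push Not at h
    exact hinf ((finite_setOf_level_lt n).subset fun u hu => h u hu)
  refine mem_levelOpen_iff.2 ⟨anc n u, anc_level_of_le hun, ?_⟩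
  exact Set.Subset.trans (Finset.coe_subset.2 (pathEdges_anc_subset n u))
    (pathEdges_subset_of_mem_openCluster hω huC)

/-- **First-moment bound** (Lyons–Peres 2016, Prop. 5.8 with `P[o ↔ x] = p^{|x|}`):
`θ_o(p) ≤ |T_n| pⁿ = 2^{lvExp n} pⁿ`. [cite: LyonsPeres2016, §5.2 Prop. 5.8 and (5.6)] -/
theorem theta_le_two_pow_lvExp_mul_pow (p : unitInterval) (n : ℕ) :
    theta tree root p ≤ 2 ^ lvExp n * (p : ℝ) ^ n := by
  have hnull : bondPercolation tree p {ω : BondConfig Vert | ω ⊆ tree.edgeSet}ᶜ = 0 := by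
    rw [Set.compl_setOf]
    exact ae_iff.1 (setBernoulli_ae_subset (u := tree.edgeSet) (p := p))
  calc theta tree root p = (bondPercolation tree p).real (percolatesAt root) := rfl
    _ = (bondPercolation tree p).real (percolatesAt root ∩ {ω | ω ⊆ tree.edgeSet}) := by
        simp only [measureReal_def, measure_inter_conull hnull]
    _ ≤ (bondPercolation tree p).real (levelOpen n) :=
        measureReal_mono (percolatesAt_inter_subset_levelOpen n) (measure_ne_top _ _)
    _ ≤ ∑ i ∈ Finset.range (2 ^ lvExp n), (bondPercolation tree p).real (pathOpen (mkV n i)) := by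
        unfold levelOpen
        exact measureReal_biUnion_finset_le _ _
    _ = ∑ _i ∈ Finset.range (2 ^ lvExp n), (p : ℝ) ^ n := by
        refine Finset.sum_congr rfl fun i _ => ?_
        rw [real_pathOpen, mkV_level]
    _ = 2 ^ lvExp n * (p : ℝ) ^ n := by
        rw [Finset.sum_const, Finset.card_range, nsmul_eq_mul]
        push_cast
        ring

/-- `2^{size n} ≤ 2n + 1` (`2^{size n - 1} ≤ n` for `n ≥ 1`). [folklore] -/
theorem two_pow_size_le (n : ℕ) : 2 ^ n.size ≤ 2 * n + 1 := by
  rcases Nat.eq_zero_or_pos n with rfl | hn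
  · simp
  · have hs : 0 < n.size := Nat.size_pos.2 hn
    have h : 2 ^ (n.size - 1) ≤ n := Nat.lt_size.1 (Nat.sub_lt hs Nat.one_pos)
    have h2 : 2 ^ n.size = 2 * 2 ^ (n.size - 1) := by
      rw [← Nat.pow_succ']
      congr 1
      omega
    omega

/-- **Below `1/2` the root does not percolate**: `θ_o(p) ≤ 4^{size n} (2p)ⁿ ≤ (2n+1)² (2p)ⁿ → 0`
(`|T_n| = 2ⁿ 4^{size n}`; first-moment method, Lyons–Peres 2016, (5.6): `p_c ≥ 1/br T = 1/2`).
[cite: LyonsPeres2016, §5.2 (5.6)] -/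
theorem theta_eq_zero_of_lt_half {p : unitInterval} (hp : (p : ℝ) < 1 / 2) :
    theta tree root p = 0 := by
  have hp0 : 0 ≤ (p : ℝ) := p.2.1
  have h2p : |2 * (p : ℝ)| < 1 := by
    rw [abs_of_nonneg (by linarith)]
    linarith
  have hbound : ∀ n : ℕ, theta tree root p ≤ ((2 * n + 1) ^ 2 : ℝ) * (2 * (p : ℝ)) ^ n := by
    intro n
    refine (theta_le_two_pow_lvExp_mul_pow p n).trans ?_
    have hsz : (2 : ℝ) ^ n.size ≤ 2 * n + 1 := by exact_mod_cast two_pow_size_le n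
    calc (2 : ℝ) ^ lvExp n * (p : ℝ) ^ n = (2 ^ n.size) ^ 2 * (2 * (p : ℝ)) ^ n := by
          rw [lvExp, pow_add, pow_mul', mul_pow]
          ring
      _ ≤ (2 * n + 1) ^ 2 * (2 * (p : ℝ)) ^ n := by
          gcongr
  have hlim : Tendsto (fun n : ℕ => ((2 * n + 1) ^ 2 : ℝ) * (2 * (p : ℝ)) ^ n) atTop (𝓝 0) := by
    have h2 := tendsto_pow_const_mul_const_pow_of_abs_lt_one 2 h2p
    have h1 := tendsto_pow_const_mul_const_pow_of_abs_lt_one 1 h2p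
    have h0 := tendsto_pow_const_mul_const_pow_of_abs_lt_one 0 h2p
    have := ((h2.const_mul 4).add (h1.const_mul 4)).add h0
    simp only [mul_zero, add_zero] at this
    refine this.congr fun n => ?_
    ring
  have hle : theta tree root p ≤ 0 := ge_of_tendsto' hlim fun n => hbound n
  exact le_antisymm hle measureReal_nonneg

/-! ### Second moment at `p = 1/2`: `P_{1/2}[o ↔ T_n] ≥ 1/2` -/

/-- `2^M ≤ Σ_{k ≤ M} 2^k`. [folklore] -/
theorem two_pow_le_sum_range (M : ℕ) : 2 ^ M ≤ ∑ k ∈ Finset.range (M + 1), 2 ^ k := by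
  rw [Finset.sum_range_succ]
  exact Nat.le_add_left _ _

/-- **Spherical symmetry in the second moment** (Lyons–Peres 2016, (5.11) summed over the level
with the uniform measure, Exercise 5.51 (b)): for a level-`n` vertex `x`,
`Σ_{y ∈ T_n} 2^{|x ∧ y|} ≤ Σ_{k ≤ n} 2^k · |T_n|/|T_k|` (in fact `2^{|x∧y|} ≤ Σ_{k ≤ |x∧y|} 2^k`
and exactly `|T_n|/|T_k| = 2^{lvExp n - lvExp k}` vertices `y` have `|x ∧ y| ≥ k`).
[cite: LyonsPeres2016, §5.3 (5.11) and Exercise 5.51 (b)] -/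
theorem sum_two_pow_findGreatest_le {n i : ℕ} (hi : i < 2 ^ lvExp n) :
    ∑ j ∈ Finset.range (2 ^ lvExp n),
        2 ^ Nat.findGreatest (fun k => anc k (mkV n i) = anc k (mkV n j)) n ≤
      ∑ k ∈ Finset.range (n + 1), 2 ^ k * 2 ^ (lvExp n - lvExp k) := by
  classical
  calc ∑ j ∈ Finset.range (2 ^ lvExp n),
        2 ^ Nat.findGreatest (fun k => anc k (mkV n i) = anc k (mkV n j)) n
      ≤ ∑ j ∈ Finset.range (2 ^ lvExp n), ∑ k ∈ (Finset.range (n + 1)).filter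
          (fun k => anc k (mkV n i) = anc k (mkV n j)), 2 ^ k := by
        refine Finset.sum_le_sum fun j _ => ?_
        refine (two_pow_le_sum_range _).trans (Finset.sum_le_sum_of_subset ?_)
        intro k hk
        have hk : k ≤ Nat.findGreatest (fun k => anc k (mkV n i) = anc k (mkV n j)) n :=
          Nat.le_of_lt_succ (Finset.mem_range.1 hk)
        rw [Finset.mem_filter, Finset.mem_range]
        exact ⟨Nat.lt_succ_of_le (hk.trans (Nat.findGreatest_le n)),
          anc_eq_of_le_findGreatest (v := mkV n i) (w := mkV n j) hk⟩
    _ = ∑ j ∈ Finset.range (2 ^ lvExp n), ∑ k ∈ Finset.range (n + 1),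
          if anc k (mkV n i) = anc k (mkV n j) then 2 ^ k else 0 := by
        refine Finset.sum_congr rfl fun j _ => ?_
        rw [Finset.sum_filter]
    _ = ∑ k ∈ Finset.range (n + 1), ∑ j ∈ Finset.range (2 ^ lvExp n),
          if anc k (mkV n i) = anc k (mkV n j) then 2 ^ k else 0 := Finset.sum_comm
    _ = ∑ k ∈ Finset.range (n + 1), 2 ^ k * 2 ^ (lvExp n - lvExp k) := by
        refine Finset.sum_congr rfl fun k hk => ?_
        rw [← Finset.sum_filter, Finset.sum_const, smul_eq_mul,
          card_filter_anc_mkV_eq (Nat.le_of_lt_succ (Finset.mem_range.1 hk)) hi, mul_comm]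

/-- `Σ_{k ≤ n} 1/(k+1)² ≤ 2 - 1/(n+1)`. [folklore] -/
theorem sum_range_inv_sq_le (n : ℕ) :
    ∑ k ∈ Finset.range (n + 1), (1 : ℝ) / ((k : ℝ) + 1) ^ 2 ≤ 2 - 1 / ((n : ℝ) + 1) := by
  induction n with
  | zero => norm_num
  | succ n ih =>
    rw [Finset.sum_range_succ]
    have hn : (0 : ℝ) < (n : ℝ) + 1 := by positivity
    have hkey : (1 : ℝ) / ((n : ℝ) + 1 + 1) ^ 2 ≤ 1 / ((n : ℝ) + 1) - 1 / ((n : ℝ) + 1 + 1) := by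
      rw [div_sub_div _ _ hn.ne' (by positivity), one_mul, mul_one]
      have hnum : (n : ℝ) + 1 + 1 - ((n : ℝ) + 1) = 1 := by ring
      rw [hnum]
      exact one_div_le_one_div_of_le (by positivity) (by nlinarith)
    push_cast
    linarith

/-- **`Σ_{k ≤ n} 2^k / |T_k| ≤ 2`**: `2^k / 2^{lvExp k} = 4^{-size k} ≤ (k+1)^{-2}` since
`k < 2^{size k}`; this is the convergence `Σ_n 1/m_n < ∞` of Lyons–Peres 2016, Exercise 5.51
(`m_n = p_cⁿ |T_n| = 4^{size n}`). [cite: LyonsPeres2016, Exercise 5.51 (b)] -/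
theorem sum_two_pow_div_two_pow_lvExp_le (n : ℕ) :
    ∑ k ∈ Finset.range (n + 1), (2 : ℝ) ^ k / 2 ^ lvExp k ≤ 2 := by
  have hterm : ∀ k : ℕ, (2 : ℝ) ^ k / 2 ^ lvExp k ≤ 1 / ((k : ℝ) + 1) ^ 2 := by
    intro k
    have hk : (k : ℝ) + 1 ≤ 2 ^ k.size := by
      exact_mod_cast Nat.succ_le_of_lt (Nat.lt_size_self k)
    have h2k : (0 : ℝ) < 2 ^ k := by positivity
    rw [show (2 : ℝ) ^ lvExp k = 2 ^ k * (2 ^ k.size) ^ 2 by rw [lvExp, pow_add, pow_mul'],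
      div_mul_eq_div_div, div_self h2k.ne']
    exact one_div_le_one_div_of_le (by positivity) (pow_le_pow_left₀ (by positivity) hk 2)
  calc ∑ k ∈ Finset.range (n + 1), (2 : ℝ) ^ k / 2 ^ lvExp k
      ≤ ∑ k ∈ Finset.range (n + 1), (1 : ℝ) / ((k : ℝ) + 1) ^ 2 :=
        Finset.sum_le_sum fun k _ => hterm k
    _ ≤ 2 - 1 / ((n : ℝ) + 1) := sum_range_inv_sq_le n
    _ ≤ 2 := by
        have : (0 : ℝ) ≤ 1 / ((n : ℝ) + 1) := by positivity
        linarith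

/-- **`4ⁿ P_{1/2}[o ↔ x, o ↔ y] ≤ 2^{|x ∧ y|}`** for `x, y ∈ T_n` (Lyons–Peres 2016, (5.11):
`P[o ↔ x, o ↔ y] = P[o ↔ x] P[o ↔ y]/P[o ↔ x ∧ y]`; here as an inequality through
`|path x ∪ path y| = 2n - |path x ∩ path y| ≥ 2n - |x ∧ y|`).
[cite: LyonsPeres2016, §5.3 (5.11)] -/
theorem four_pow_mul_real_inter_le {n i j : ℕ} :
    (4 : ℝ) ^ n * (bondPercolation tree half).real (pathOpen (mkV n i) ∩ pathOpen (mkV n j)) ≤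
      2 ^ Nat.findGreatest (fun k => anc k (mkV n i) = anc k (mkV n j)) n := by
  rw [real_pathOpen_inter, coe_half]
  set c := (pathEdges (mkV n i) ∩ pathEdges (mkV n j)).card with hc
  have hcM : c ≤ Nat.findGreatest (fun k => anc k (mkV n i) = anc k (mkV n j)) n :=
    card_inter_pathEdges_le (mkV n i) (mkV n j)
  have hMn : Nat.findGreatest (fun k => anc k (mkV n i) = anc k (mkV n j)) n ≤ n :=
    Nat.findGreatest_le n
  have hcard : (pathEdges (mkV n i) ∪ pathEdges (mkV n j)).card = 2 * n - c := by
    have h := Finset.card_union_add_card_inter (pathEdges (mkV n i)) (pathEdges (mkV n j))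
    rw [card_pathEdges, card_pathEdges, mkV_level, mkV_level] at h
    omega
  rw [hcard]
  have h4 : (4 : ℝ) ^ n = 2 ^ (2 * n - c) * 2 ^ c := by
    rw [← pow_add, Nat.sub_add_cancel (by omega), pow_mul]
    norm_num
  have h : (4 : ℝ) ^ n * (1 / 2) ^ (2 * n - c) = 2 ^ c := by
    rw [h4, one_div, inv_pow, mul_right_comm, mul_inv_cancel₀ (pow_ne_zero _ two_ne_zero),
      one_mul]
  rw [h]
  exact pow_le_pow_right₀ (by norm_num) hcM

/-- **`E[X_n²] ≤ 2 E[X_n]²` at `p = 1/2`**: `Σ_{x,y ∈ T_n} P_{1/2}[o ↔ x, o ↔ y] ≤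
2 (|T_n| 2^{-n})²` (`X_n` = number of level-`n` vertices joined to the root along their tree
paths, `E[X_n] = |T_n| 2^{-n} = 4^{size n}`). [cite: LyonsPeres2016, §5.3 Prop. 5.11 and (5.11), Exercise 5.51 (b)] -/
theorem sum_sum_real_inter_le (n : ℕ) :
    ∑ i ∈ Finset.range (2 ^ lvExp n), ∑ j ∈ Finset.range (2 ^ lvExp n),
        (bondPercolation tree half).real (pathOpen (mkV n i) ∩ pathOpen (mkV n j)) ≤
      2 * ((2 : ℝ) ^ lvExp n / 2 ^ n) ^ 2 := by
  set μ := bondPercolation tree half with hμ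
  have h4 : (0 : ℝ) < 4 ^ n := by positivity
  have h42 : (4 : ℝ) ^ n = (2 ^ n) ^ 2 := by
    rw [← pow_mul, mul_comm, pow_mul]
    norm_num
  -- each row, multiplied by `4ⁿ`, is at most `Σ_k 2^k |T_n|/|T_k|`
  have hrow : ∀ i ∈ Finset.range (2 ^ lvExp n),
      (4 : ℝ) ^ n * ∑ j ∈ Finset.range (2 ^ lvExp n), μ.real (pathOpen (mkV n i) ∩ pathOpen (mkV n j))
        ≤ ∑ k ∈ Finset.range (n + 1), (2 : ℝ) ^ k * 2 ^ (lvExp n - lvExp k) := by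
    intro i hi
    have hi' : i < 2 ^ lvExp n := Finset.mem_range.1 hi
    have hnat : (∑ j ∈ Finset.range (2 ^ lvExp n),
        (2 : ℝ) ^ Nat.findGreatest (fun k => anc k (mkV n i) = anc k (mkV n j)) n) ≤
        ∑ k ∈ Finset.range (n + 1), (2 : ℝ) ^ k * 2 ^ (lvExp n - lvExp k) := by
      exact_mod_cast sum_two_pow_findGreatest_le hi'
    refine le_trans ?_ hnat
    rw [Finset.mul_sum]
    exact Finset.sum_le_sum fun j _ => four_pow_mul_real_inter_le
  -- the level sum `Σ_k 2^k |T_n|/|T_k| = |T_n| Σ_k 2^k/|T_k| ≤ 2 |T_n|`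
  have hlevel : ∑ k ∈ Finset.range (n + 1), (2 : ℝ) ^ k * 2 ^ (lvExp n - lvExp k) ≤
      2 * 2 ^ lvExp n := by
    have heq : ∑ k ∈ Finset.range (n + 1), (2 : ℝ) ^ k * 2 ^ (lvExp n - lvExp k) =
        2 ^ lvExp n * ∑ k ∈ Finset.range (n + 1), (2 : ℝ) ^ k / 2 ^ lvExp k := by
      rw [Finset.mul_sum]
      refine Finset.sum_congr rfl fun k hk => ?_
      have hk : k ≤ n := Nat.le_of_lt_succ (Finset.mem_range.1 hk)
      rw [pow_sub₀ _ two_ne_zero (lvExp_mono hk), div_eq_mul_inv]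
      ring
    rw [heq]
    have h2 : (0 : ℝ) ≤ 2 ^ lvExp n := by positivity
    nlinarith [sum_two_pow_div_two_pow_lvExp_le n, h2]
  -- assemble
  rw [← mul_le_mul_iff_right₀ h4, Finset.mul_sum]
  calc ∑ i ∈ Finset.range (2 ^ lvExp n), (4 : ℝ) ^ n *
        ∑ j ∈ Finset.range (2 ^ lvExp n), μ.real (pathOpen (mkV n i) ∩ pathOpen (mkV n j))
      ≤ ∑ _i ∈ Finset.range (2 ^ lvExp n), (2 : ℝ) * 2 ^ lvExp n :=
        Finset.sum_le_sum fun i hi => (hrow i hi).trans hlevel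
    _ = 4 ^ n * (2 * ((2 : ℝ) ^ lvExp n / 2 ^ n) ^ 2) := by
        rw [Finset.sum_const, Finset.card_range, nsmul_eq_mul, h42]
        push_cast
        field_simp

/-- **`P_{1/2}[o ↔ T_n along tree paths] ≥ 1/2` for every `n`** (second-moment method,
Lyons–Peres 2016, Prop. 5.11: `P[o ↔ Π] ≥ E[X]²/E[X²] ≥ 1/2`).
[cite: LyonsPeres2016, §5.3 Prop. 5.11 and Exercise 5.51 (b)] -/
theorem half_le_real_levelOpen (n : ℕ) :
    1 / 2 ≤ (bondPercolation tree half).real (levelOpen n) := by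
  set μ := bondPercolation tree half with hμ
  have hCS := sq_sum_measureReal_le_measureReal_biUnion_mul_sum μ (Finset.range (2 ^ lvExp n))
    (fun i => pathOpen (mkV n i)) (fun i _ => measurableSet_pathOpen _)
  change (∑ i ∈ Finset.range (2 ^ lvExp n), μ.real (pathOpen (mkV n i))) ^ 2 ≤
    μ.real (levelOpen n) * _ at hCS
  have hsum : ∑ i ∈ Finset.range (2 ^ lvExp n), μ.real (pathOpen (mkV n i)) =
      (2 : ℝ) ^ lvExp n / 2 ^ n := by
    rw [Finset.sum_congr rfl fun i _ => real_pathOpen half (mkV n i)]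
    simp only [mkV_level, coe_half, Finset.sum_const, Finset.card_range, nsmul_eq_mul, one_div,
      inv_pow]
    push_cast
    ring
  rw [hsum] at hCS
  have hm : (0 : ℝ) < ((2 : ℝ) ^ lvExp n / 2 ^ n) ^ 2 := by positivity
  have h2 : ((2 : ℝ) ^ lvExp n / 2 ^ n) ^ 2 ≤
      μ.real (levelOpen n) * (2 * ((2 : ℝ) ^ lvExp n / 2 ^ n) ^ 2) :=
    hCS.trans (mul_le_mul_of_nonneg_left (sum_sum_real_inter_le n) measureReal_nonneg)
  nlinarith [h2, hm]

/-- An open tree path from the root to `v` puts `v` in the open cluster of the root.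
[folklore] -/
theorem reachable_of_pathEdges_subset {ω : BondConfig Vert} :
    ∀ (n : ℕ) (v : Vert), v.1.1 = n → ↑(pathEdges v) ⊆ ω → (openGraph ω).Reachable root v := by
  intro n
  induction n with
  | zero => intro v hv _; rw [eq_root_of_level hv]
  | succ n ih =>
    intro v hv hω
    have hpar : (openGraph ω).Reachable root (parent v) :=
      ih (parent v) (by rw [parent_level, hv, Nat.add_sub_cancel])
        (Set.Subset.trans (Finset.coe_subset.2 (pathEdges_parent_subset v)) hω)
    have hv0 : v ≠ root := fun h => by
      rw [h, root_level] at hv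
      exact Nat.succ_ne_zero n hv.symm
    refine hpar.trans (SimpleGraph.Adj.reachable ?_)
    rw [openGraph_adj]
    exact ⟨hω (Finset.mem_coe.2 (mem_pathEdges_parent hv)), parent_ne hv0⟩

/-- **`⋂_n [o ↔ T_n] ⊆ [o ↔ ∞]`**: open tree paths to every level make the cluster of the root
infinite (Lyons–Peres 2016, (5.9)). [cite: LyonsPeres2016, §5.3 (5.9)] -/
theorem iInter_levelOpen_subset_percolatesAt :
    (⋂ n, levelOpen n) ⊆ (percolatesAt root : Set (BondConfig Vert)) := by
  intro ω hω
  rw [Set.mem_iInter] at hω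
  have hlev : ∀ n, ∃ u ∈ openCluster ω root, u.1.1 = n := by
    intro n
    obtain ⟨v, hv, hvω⟩ := mem_levelOpen_iff.1 (hω n)
    exact ⟨v, reachable_of_pathEdges_subset n v hv hvω, hv⟩
  show (openCluster ω root).Infinite
  intro hfin
  obtain ⟨B, hB⟩ := (hfin.image fun u : Vert => u.1.1).bddAbove
  obtain ⟨u, hu, hul⟩ := hlev (B + 1)
  have := hB ⟨u, hu, hul⟩
  omega

/-- **The tree percolates at `p = 1/2`: `θ_o(1/2) ≥ 1/2`** (Lyons–Peres 2016, Exercise 5.12 /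
Exercise 5.51 (b): `Σ_n 1/m_n < ∞` on a spherically symmetric tree; here via Prop. 5.11 on each
level and continuity from above along the decreasing events `[o ↔ T_n]`, (5.9)).
[cite: LyonsPeres2016, Exercise 5.12 and Exercise 5.51 (b)] -/
theorem half_le_theta_half : 1 / 2 ≤ theta tree root half := by
  set μ := bondPercolation tree half with hμ
  have hmeas : ∀ n, NullMeasurableSet (levelOpen n) μ := fun n =>
    (measurableSet_levelOpen n).nullMeasurableSet
  have hiInter : μ (⋂ n, levelOpen n) = ⨅ n, μ (levelOpen n) :=
    levelOpen_antitone.measure_iInter hmeas ⟨0, measure_ne_top _ _⟩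
  have hge : ENNReal.ofReal (1 / 2) ≤ μ (⋂ n, levelOpen n) := by
    rw [hiInter]
    refine le_iInf fun n => ?_
    rw [ENNReal.ofReal_le_iff_le_toReal (measure_ne_top _ _)]
    exact half_le_real_levelOpen n
  have hle : μ (⋂ n, levelOpen n) ≤ μ (percolatesAt root) :=
    measure_mono iInter_levelOpen_subset_percolatesAt
  show 1 / 2 ≤ μ.real (percolatesAt root)
  rw [measureReal_def, ← ENNReal.ofReal_le_iff_le_toReal (measure_ne_top _ _)]
  exact hge.trans hle

/-! ### The critical probability is `1/2`, and the tree percolates there -/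

/-- **`p_c = 1/2`** for the tree rooted at `root`: `θ_o(1/2) > 0` puts `1/2` in the set whose
infimum defines `p_c`, and every member of that set is `≥ 1/2` since `θ_o(p) = 0` for `p < 1/2`
(Lyons–Peres 2016, Thm. 5.15 / (5.6): `p_c(T) = 1/br T`, `br T = 2` here).
[cite: LyonsPeres2016, §5.2 (5.6) and Thm. 5.15] -/
theorem criticalProb_eq_half : criticalProb tree root = 1 / 2 := by
  have hpos : 0 < theta tree root half := lt_of_lt_of_le (by norm_num) half_le_theta_half
  refine IsLeast.csInf_eq ⟨Or.inl ⟨half.2, hpos⟩, ?_⟩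
  rintro q (⟨hq, hθ⟩ | hq1)
  · by_contra hlt
    push Not at hlt
    exact hθ.ne' (theta_eq_zero_of_lt_half (p := ⟨q, hq⟩) hlt)
  · rw [Set.mem_singleton_iff.1 hq1]
    norm_num

/-- **Percolation at criticality: `θ_o(p_c) > 0`** for the tree (Lyons–Peres 2016,
Exercise 5.12). [cite: LyonsPeres2016, Exercise 5.12 and Exercise 5.51 (b)] -/
theorem theta_criticalProb_pos :
    0 < theta tree root ⟨criticalProb tree root, criticalProb_mem_Icc tree root⟩ := by
  have h : (⟨criticalProb tree root, criticalProb_mem_Icc tree root⟩ : unitInterval) = half :=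
    Subtype.ext criticalProb_eq_half
  rw [h]
  exact lt_of_lt_of_le (by norm_num) half_le_theta_half

/-! ### Transfer along a bijection of the vertex type -/

/-- `θ` is invariant under relabelling the vertices by a bijection (the restriction coupling
`theta_comap_le` in both directions). [folklore] -/
theorem theta_comap_equiv {V W : Type*} [Countable V] [Countable W] (G : SimpleGraph V)
    (e : W ≃ V) (x : W) (p : unitInterval) : theta (G.comap e) x p = theta G (e x) p := by
  refine le_antisymm (theta_comap_le G e.injective x p) ?_
  have h := theta_comap_le (G.comap e) e.symm.injective (e x) p
  rwa [SimpleGraph.comap_comap, Equiv.self_comp_symm, SimpleGraph.comap_id,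
    Equiv.symm_apply_apply] at h

/-- `p_c` is invariant under relabelling the vertices by a bijection. [folklore] -/
theorem criticalProb_comap_equiv {V W : Type*} [Countable V] [Countable W] (G : SimpleGraph V)
    (e : W ≃ V) (x : W) : criticalProb (G.comap e) x = criticalProb G (e x) := by
  unfold criticalProb
  simp_rw [theta_comap_equiv]

/-- Local finiteness is invariant under relabelling the vertices by a bijection. [folklore] -/
theorem neighborSet_comap_equiv_finite {V W : Type*} (G : SimpleGraph V) (e : W ≃ V)
    (h : ∀ v, (G.neighborSet v).Finite) (w : W) : ((G.comap e).neighborSet w).Finite := by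
  have hset : (G.comap e).neighborSet w = e ⁻¹' G.neighborSet (e w) := by
    ext u
    simp [SimpleGraph.mem_neighborSet, SimpleGraph.comap_adj]
  rw [hset]
  exact (h (e w)).preimage e.injective.injOn

end CritTree

end Literature.Barriers.CriticalPhenomena

end
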